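import Literature.AlgebraicGeometry.Milne1999.CMTypeSubquotients
import HarnessLib

/-!
# A complex abelian variety is of CM-type iff it is isogenous to a product of SIMPLE abelian varieties of CM-type

Milne, *Lefschetz motives and the Tate conjecture*, Compositio Math. 117 (1999), §2 p. 54: «A simple
Abelian variety `A` over `C` is said to be of CM-type if `End⁰(A)` is a field (necessarily CM) of
degree `2 dim A` over `Q`, and an arbitrary Abelian variety over `C` is said to be of CM-type if all
its simple isogeny factors are of CM-type»; Milne, arXiv:math/9806172, p. 22: «`A` is of CM-type if,
for each simple isogeny factor `B` of `A_{k^al}`, `End⁰(B)` is a CM-field of degree `2 dim B`»;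
Deligne, LNM 900 (1982), §5 p. 63: «`A` is of CM-type if and only if each `A_α` is of CM-type».
Behind these is the Poincaré decomposition `A ∼ ∏ A_i^{r_i}` into simple factors (Mumford §19 Thm. 1
Cor. 1; Milne 1986 §12 p. 122).

For the tree's étale rendering `Milne1999.IsOfCMType` this file PROVES the structure statement
itself, unconditionally: **`A` is of CM-type iff `A` is isogenous to a finite product of simple
abelian varieties of CM-type** — the hereditary Poincaré decomposition
(`AbelianVariety.exists_isogeny_from_productOf_simple_of_hereditary`) applied to the hereditary
property «of CM-type» (`ComplexMultiplication.hSub_holds`: abelian subvarieties of CM abelian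
varieties are CM, `Milne1999/CMTypeSubquotients`), with the converse by `isOfCMType_of_isProductOf`
and isogeny invariance:

* `IsOfCMType.exists_isogeny_from_productOf_simple` — `∃ P → A` isogeny, `P` a finite product of
  SIMPLE abelian varieties OF CM-TYPE (each positive-dimensional factor then has `End⁰` a field of
  degree `2 dim`, `IsOfCMType.isOfCMTypeSimple`: `…_productOf_simple_milne`);
* `IsOfCMType.exists_productOf_simple_isIsogenous` — the same as `IsIsogenous A P`;
* `isOfCMType_iff_exists_isIsogenous_productOf_simple` — **the equivalence**;
* `isOfCMType_iff_exists_isIsogenous_productOf_simple_milne` — the equivalence with Milne's printed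
  clause at the factors (`dim B = 0 ∨ IsOfCMTypeSimple B`; the disjunct `dim B = 0` only because the
  tree's `IsSimple` admits the zero abelian variety).

No definition, no named fact: theorems only.

## References
* [Milne1999] J. S. Milne, Compositio Math. 117 (1999), §2 p. 54.
* [Milne1998CMPedestrians] J. S. Milne, arXiv:math/9806172, p. 22.
* [Deligne1982HodgeCycles] P. Deligne, LNM 900 (1982), §5 p. 63 and Prop. 5.1.
* [MumfordAV1970] D. Mumford, *Abelian Varieties* (1970), §19 Thm. 1 Cor. 1 (pp. 173–174).
* [Milne1986AbelianVarieties] J. S. Milne, *Abelian Varieties* (in Cornell–Silverman 1986), §12 p. 122.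
-/

noncomputable section

open CategoryTheory

namespace Literature.AlgebraicGeometry.Milne1999

open _root_.AlgebraicGeometry
open Literature.AlgebraicGeometry.Motives Literature.AlgebraicGeometry.Motives.AbelianVariety
open Literature.AlgebraicGeometry.ComplexMultiplication

variable {A : AbelianVariety ℂ}

/-- **A complex abelian variety of CM-type receives an isogeny from a finite product of SIMPLE
abelian varieties of CM-type** (hereditary Poincaré decomposition for the hereditary property
«of CM-type», `hSub_holds`; Mumford §19 Cor. 1). [cite: MumfordAV1970, §19 Thm. 1 Cor. 1 (pp. 173–174)]
[cite: Milne1999, §2 p. 54] [cite: Deligne1982HodgeCycles, §5 p. 63 and Prop. 5.1] -/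
theorem IsOfCMType.exists_isogeny_from_productOf_simple (hA : IsOfCMType A) :
    ∃ (P : AbelianVariety ℂ) (g : P ⟶ A),
      AbelianVariety.IsProductOf (fun B => AbelianVariety.IsSimple B ∧ IsOfCMType B) P ∧
        AbelianVariety.IsIsogeny g :=
  exists_isogeny_from_productOf_simple_of_hereditary IsOfCMType hSub_holds A hA

/-- **A complex abelian variety of CM-type is isogenous to a finite product of simple abelian
varieties of CM-type** (`IsIsogenous A P`; isogeny is symmetric in characteristic zero,
`IsIsogenous.symm_of_charZero`). [cite: Milne1999, §2 p. 54] [cite: MumfordAV1970, §19 Thm. 1 Cor. 1 (pp. 173–174)]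
[cite: Milne1998CMPedestrians, p. 22] -/
theorem IsOfCMType.exists_productOf_simple_isIsogenous (hA : IsOfCMType A) :
    ∃ P : AbelianVariety ℂ,
      AbelianVariety.IsProductOf (fun B => AbelianVariety.IsSimple B ∧ IsOfCMType B) P ∧
        AbelianVariety.IsIsogenous A P := by
  obtain ⟨P, g, hP, hg⟩ := hA.exists_isogeny_from_productOf_simple
  exact ⟨P, hP, AbelianVariety.IsIsogenous.symm_of_charZero (A := P) (B := A) ⟨g, hg⟩⟩

/-- **`A` is of CM-type iff `A` is isogenous to a finite product of simple abelian varieties of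
CM-type** (Milne 1999 p. 54 / Deligne LNM 900 §5 p. 63, for the étale rendering; `⇐`: a product of
CM abelian varieties is CM, `isOfCMType_of_isProductOf`, and CM-type is an isogeny invariant).
[cite: Milne1999, §2 p. 54] [cite: Deligne1982HodgeCycles, §5 p. 63 and Prop. 5.1]
[cite: MumfordAV1970, §19 Thm. 1 Cor. 1 (pp. 173–174)] -/
theorem isOfCMType_iff_exists_isIsogenous_productOf_simple :
    IsOfCMType A ↔ ∃ P : AbelianVariety ℂ,
      AbelianVariety.IsProductOf (fun B => AbelianVariety.IsSimple B ∧ IsOfCMType B) P ∧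
        AbelianVariety.IsIsogenous A P := by
  refine ⟨fun hA => hA.exists_productOf_simple_isIsogenous, ?_⟩
  rintro ⟨P, hP, hAP⟩
  exact (isOfCMType_iff_of_isIsogenous hAP).2 (isOfCMType_of_isProductOf hP fun _ h => h.2)

/-- The factors in Milne's printed form: a complex abelian variety of CM-type is isogenous to a
finite product of simple abelian varieties `B` each with `End⁰(B)` a field of degree `2 dim B`
(`IsOfCMTypeSimple B`; `IsOfCMType.isOfCMTypeSimple`, Shimura §5.1 Props. 3, 4, 6) — or `dim B = 0`
(the tree's `IsSimple` admits the zero abelian variety, whose `End⁰ = 0` is not a field).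
[cite: Milne1999, §2 p. 54] [cite: Shimura1998, §5.1 Propositions 3, 4, 6]
[cite: MumfordAV1970, §19 Thm. 1 Cor. 1 (pp. 173–174)] -/
theorem IsOfCMType.exists_productOf_simple_milne_isIsogenous (hA : IsOfCMType A) :
    ∃ P : AbelianVariety ℂ,
      AbelianVariety.IsProductOf
          (fun B => AbelianVariety.IsSimple B ∧ (B.dim = 0 ∨ IsOfCMTypeSimple B)) P ∧
        AbelianVariety.IsIsogenous A P := by
  obtain ⟨P, hP, hAP⟩ := hA.exists_productOf_simple_isIsogenous
  refine ⟨P, hP.mono fun B h => ⟨h.1, ?_⟩, hAP⟩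
  rcases Nat.eq_zero_or_pos B.dim with h0 | hpos
  · exact Or.inl h0
  · exact Or.inr (h.2.isOfCMTypeSimple h.1 hpos)

/-- **`A` is of CM-type iff `A` is isogenous to a finite product of simple abelian varieties each
with `End⁰` a field of degree `2 dim` (or zero)** — Milne's printed definition (Compositio 117
p. 54) as an EQUIVALENCE with the étale rendering, through the isogeny decomposition rather than
through simple isogeny factors one at a time (`isOfCMType_iff_isOfCMTypeMilne`).
[cite: Milne1999, §2 p. 54] [cite: Milne1998CMPedestrians, p. 22]
[cite: MumfordAV1970, §19 Thm. 1 Cor. 1 (pp. 173–174)] -/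
theorem isOfCMType_iff_exists_isIsogenous_productOf_simple_milne :
    IsOfCMType A ↔ ∃ P : AbelianVariety ℂ,
      AbelianVariety.IsProductOf
          (fun B => AbelianVariety.IsSimple B ∧ (B.dim = 0 ∨ IsOfCMTypeSimple B)) P ∧
        AbelianVariety.IsIsogenous A P := by
  refine ⟨fun hA => hA.exists_productOf_simple_milne_isIsogenous, ?_⟩
  rintro ⟨P, hP, hAP⟩
  refine (isOfCMType_iff_of_isIsogenous hAP).2 (isOfCMType_of_isProductOf hP fun B h => ?_)
  rcases h.2 with h0 | hs
  · exact isOfCMType_of_dim_eq_zero h0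
  · exact hs.isOfCMType

end Literature.AlgebraicGeometry.Milne1999
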